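import Literature.AlgebraicGeometry.HodgeTheory.WeilFamilyReachOfSystem
import Literature.AlgebraicGeometry.HodgeTheory.WeilFamilyGlobalAction
import Literature.AlgebraicGeometry.HodgeTheory.WeilLineSectionsOfUnimodularMonodromy
import Literature.AlgebraicGeometry.HodgeTheory.HolomorphicBundleChernCharacterProjectiveSpace
import Literature.AlgebraicGeometry.HodgeTheory.AlgebraicClassesHodgeTypeHolds
import HarnessLib

/-!
# Deligne's hyperbolic Weil family: both named facts from the abelian scheme with `K`-action and special-unitary monodromy

Family `hodge`, layer `Literature/AlgebraicGeometry/HodgeTheory`; theorems only (no definition, no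
named fact, D-0026), continuing `WeilFamilyReachOfSystem` in support of the named facts
`weilFamilyReach_hyperbolic` (`HodgeTheory/WeilFamilyReach`) and
`weilFamily_hyperbolic_weilSystem_reach` (`HodgeTheory/WeilFamilyReachSystem`).

`WeilFamilyReachOfSystem` proved `weilFamilyReach_hyperbolic` = (the clauses of
`weilFamily_hyperbolic_weilSystem_reach`) + (clause (a): a global class `H`, rational of type `(1,1)`
on every fibre, restricting to `h_K` at `s₀`). Both packages still ASSERT Hodge theory along the
family: flat sections of `R²ⁿ f_* ℂ` through every Weil class, of type `(n, n)` at every fibre, with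
values in the Weil planes, and the fibrewise type of `H`. In the printed proof
([Deligne1982HodgeCycles, proof of Thm. 4.8, pp. 48–50]; [vanGeemen1994HodgeAV, 5.8–5.11]) these
are CONSEQUENCES of what the construction delivers: the universal abelian scheme `f : 𝒳 → S` over
the connected Shimura variety `S = Γ\X⁺` with its action of `√-d` ("an action `ν` of `E` on `Y/S`",
p. 48), all of whose fibres are of balanced type `(n, n)` ("(a) for all `s ∈ S`, `(Y_s, ν_s)`
satisfies the equivalent statements in (4.4)"), whose monodromy is special unitary ("`Γ ⊂ SU`, so
`det_E γ = 1`", p. 50; `Γ_Λ ⊂ SU(n,n)`, [vanGeemen1994HodgeAV, 5.11]), embedded in `ℙᴺ × S` by a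
power of the universal polarization ([MumfordFogartyKirwan1994, Thm. 7.9–7.10]; p. 50 "polarized").
This file proves that bookkeeping on the tree's real carriers, so that the residual content of BOTH
named facts is exactly the constructor's output:

* `finrank_eigenspace_eq_of_chart_comm` — a chart `e : A.X ≅ Y` with `e.hom ≫ g_Y = φ ≫ e.hom`
  identifies the `μ`-eigenspaces of `g_Y^*` and `φ^*` on `Hᵏ` (equal dimensions);
* `polarizedWeilSystem_of_unitaryMonodromyFamily` — MAIN: from, for every hyperbolic
  `(P, ψ₀, h_K)`, (1) an embedded smooth projective family `f : 𝒳 → S`, `ι : 𝒳 ↪ ℙᴺ × S`, over an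
  irreducible smooth quasi-projective `S`, `e' : P ≅ 𝒳_{s₀}`; (2) a GLOBAL endomorphism `g` of `𝒳`
  over `S` inducing `ψ₀` at `s₀` and `Ψ_s` on abelian `2n`-fold charts `ε_s : Y_s ≅ 𝒳_s`,
  `Ψ_s² = -d`, of ALL fibres; (3) every `(Y_s, Ψ_s)` of balanced type:
  `dim (V₊(Y_s) ∩ H^{1,0}) = n`; (4) special-unitary monodromy at `s₀`: every loop transports the
  two eigenspaces `V_{±i√d}` of `g_{s₀}^*` on `H¹(𝒳_{s₀})` with determinant `1`; (5) reach of every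
  hyperbolic `(A, φ, h_K(A))` by a `K`-isogeny from some `Y_s`; (6) a RATIONAL ambient class
  `a' ∈ H²(ℙᴺ(ℂ); ℂ)` whose relative hyperplane-type class `H := (ι ≫ pr₁)^* a'` restricts at `s₀` to
  `h_K` (the embedding is by the `K`-symmetrised polarization) — the polarized family-first package of
  `WeilFamilyReachOfSystem` follows: the Weil plane of `P` read on `𝒳_{s₀}` is the cohomological Weil
  plane `Span(⌣²ⁿ V₊) ⊔ Span(⌣²ⁿ V₋)` (`map_inv_mem_eigenLines_of_mem_weilClassesOf`), pointwise
  fixed by special-unitary monodromy, hence every Weil class extends to a continuous section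
  (`exists_continuous_section_of_det_restrict_eq_one`, Voisin II Lemma 4.17); its values are
  transports (`transportFun_clsAt_of_continuous`), stay in the Weil planes
  (`transportFun_mem_eigenLines`), are read in the charts as Weil classes of `(Y_s, Ψ_s)`
  (`map_mem_weilClassesOf_of_mem_eigenLines`) and are of type `(n, n)` by Prop. 4.4
  (`isOfHodgeType_of_mem_weilClassesOf`, `WeilClassesHodgeType`); `H|_{𝒳_s} = (ι_s ≫ ι ≫ pr₁)^* a'`
  is rational (pull-back of a rational class) and of type `(1,1)` (every class of `H²(ℙᴺ)` is
  algebraic, `algebraicClasses_projectiveSpace_eq_top`, hence of type `(1,1)`,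
  `isOfHodgeType_of_mem_algebraicClasses_of_isSmoothProjective`, and pull-backs between smooth
  projective varieties preserve Hodge types, `IsOfHodgeType.map_of_isSmoothProjective`);
* `weilFamilyReach_hyperbolic_of_unitaryMonodromyFamily`,
  `weilFamily_hyperbolic_weilSystem_reach_of_unitaryMonodromyFamily` — hence BOTH named facts
  (`weilFamilyReach_hyperbolic_of_polarizedWeilSystem`,
  `weilFamily_hyperbolic_weilSystem_reach_of_polarizedWeilSystem`).

So the debt of `weilFamilyReach_hyperbolic` and of its family-first sibling is reduced to the
printed construction itself — the universal PEL abelian scheme over `Γ\X⁺` with its `√-d`, its type,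
its monodromy group and its period-point reach (complex uniformisation) — with no Hodge theory along
the family left to assert. The hypothesis package is stated inline (this file mints no named fact).

## References

* [Deligne1982HodgeCycles] P. Deligne (notes by J. S. Milne), Hodge cycles on abelian varieties,
  LNM 900 (1982), Prop. 4.4, Thm. 4.8 and its proof pp. 47–52 (clauses (a)–(c), p. 48; "`Γ ⊂ SU`",
  p. 50).
* [vanGeemen1994HodgeAV] B. van Geemen, An introduction to the Hodge conjecture for abelian
  varieties, LNM 1594 (1994), Lemma 5.2, 5.3–5.4, 5.8–5.11.
* [MumfordFogartyKirwan1994] D. Mumford, J. Fogarty, F. Kirwan, Geometric Invariant Theory, 3rd ed.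
  (1994), Thm. 7.9–7.10.
* [VoisinHodgeII2003] C. Voisin, Hodge Theory and Complex Algebraic Geometry II, CUP 2003,
  Lemma 4.17, §3.1.2.
* [VoisinHodgeI2002] C. Voisin, Hodge Theory and Complex Algebraic Geometry I, CUP 2002, §7.3.2,
  §11.1.2.
-/

noncomputable section

namespace Literature.AlgebraicGeometry.HodgeTheory

open CategoryTheory _root_.AlgebraicGeometry
open Literature.AlgebraicGeometry Literature.AlgebraicGeometry.Motives
open Literature.AlgebraicTopology.SingularHomology

/-! ### Eigenspaces through a compatible chart have the same dimension -/

/-- **A compatible chart identifies eigenspaces.** For `e : A.X ≅ Y` and `g_Y : Y ⟶ Y` with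
`e.hom ≫ g_Y = φ ≫ e.hom`, the linear isomorphism `e^* : Hᵏ(Y(ℂ); ℂ) ≃ Hᵏ(A(ℂ); ℂ)` carries the
`μ`-eigenspace of `g_Y^*` onto the `μ`-eigenspace of `φ^*` (`map_hom_mem_eigenspace_of_comm`,
`map_inv_mem_eigenspace_of_comm`), so the two have the same dimension. [folklore] -/
theorem finrank_eigenspace_eq_of_chart_comm {A : AbelianVariety ℂ} {Y : SchemeOver ℂ} {φ : A ⟶ A}
    (e : A.X ≅ Y) (gY : Y ⟶ Y) (he : e.hom ≫ gY = φ.hom.hom.hom ≫ e.hom) (k : ℕ) (μ : ℂ) :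
    Module.finrank ℂ ↥(Module.End.eigenspace (complexBetti.map gY k).hom μ) =
      Module.finrank ℂ ↥(Module.End.eigenspace (complexBetti.map φ.hom.hom.hom k).hom μ) := by
  -- `e^*` and `(e⁻¹)^*` are inverse linear maps
  have h₁ : ∀ v : complexBetti A.X k, complexBetti.map e.hom k (complexBetti.map e.inv k v) = v := by
    intro v
    rw [← ModuleCat.comp_apply, ← complexBetti.map_comp, e.hom_inv_id, complexBetti.map_id]
    rfl
  have h₂ : ∀ v : complexBetti Y k, complexBetti.map e.inv k (complexBetti.map e.hom k v) = v := by
    intro v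
    rw [← ModuleCat.comp_apply, ← complexBetti.map_comp, e.inv_hom_id, complexBetti.map_id]
    rfl
  let E : complexBetti Y k ≃ₗ[ℂ] complexBetti A.X k :=
    LinearEquiv.ofLinear (complexBetti.map e.hom k).hom (complexBetti.map e.inv k).hom
      (LinearMap.ext fun v ↦ h₁ v) (LinearMap.ext fun v ↦ h₂ v)
  have hE : ∀ v, E v = complexBetti.map e.hom k v := fun _ ↦ rfl
  refine LinearEquiv.finrank_eq (LinearEquiv.ofSubmodules E _ _ ?_)
  apply le_antisymm
  · rintro _ ⟨v, hv, rfl⟩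
    exact map_hom_mem_eigenspace_of_comm e gY he hv
  · intro v hv
    refine ⟨complexBetti.map e.inv k v, map_inv_mem_eigenspace_of_comm e gY he hv, ?_⟩
    change E (complexBetti.map e.inv k v) = v
    rw [hE, h₁]

/-! ### The polarized family-first package from the abelian scheme with `K`-action -/

/-- **Deligne's construction outputs ⟹ the polarized family-first package.** Suppose that for all
`n, d ≥ 1` and every hyperbolic `(P, ψ₀, h_K)` (`dim P = 2n`, `ψ₀² = -d`,
`h_K = d·e^*a + ψ₀^*e^*a`, `a` rational non-zero) there are: (1) a smooth projective family
`f : 𝒳 → S` of relative dimension `2n` with a closed immersion `ι : 𝒳 ↪ ℙᴺ × S` over `S`, `S`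
irreducible, smooth and quasi-projective, and `e' : P ≅ 𝒳_{s₀}`; (2) an endomorphism `g` of `𝒳` OVER
`S` ("an action `ν` of `E = ℚ(√-d)` on `Y/S`", [Deligne1982HodgeCycles, p. 48]) inducing `ψ₀` on `P`
through `e'` and, at every `s`, the `√-d` `Ψ_s` (`Ψ_s² = -d`) of an abelian `2n`-fold `Y_s` through a
chart `ε_s : Y_s ≅ 𝒳_s`; (3) every `(Y_s, Ψ_s)` of balanced type `(n, n)`:
`dim (V₊ ∩ H^{1,0}(Y_s)) = n`, `V₊` the `i√d`-eigenspace of `Ψ_s^*` on `H¹` (clause (a) of loc. cit.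
with [Deligne1982HodgeCycles, Prop. 4.4]); (4) SPECIAL-UNITARY MONODROMY at `s₀`: along every loop at
`s₀` the transport of `R¹ f_* ℂ` has determinant `1` on both eigenspaces `V_{±i√d}` of `g_{s₀}^*` on
`H¹(𝒳_{s₀}(ℂ); ℂ)` ("`Γ ⊂ SU`, so `det_E γ = 1`", p. 50; `Γ_Λ ⊂ SU(n, n)`, [vanGeemen1994HodgeAV,
5.11]); (5) REACH: every hyperbolic `(A, φ, h_K(A))` of the same `(2n, d)` is `K`-isogenous to some
`Y_s` (`u : Y_s → A` finite flat, `v : A → Y_s`, `u ≫ v = [m]`, `m ≥ 1`, `v ≫ Ψ_s = φ ≫ v`;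
[vanGeemen1994HodgeAV, 5.3–5.4, 5.8–5.10]: hyperbolic Hermitian forms of equal rank are isometric and
`X⁺` is connected); (6) POLARIZATION: a rational class `a' ∈ H²(ℙᴺ(ℂ); ℂ)` with
`e'^*((ι_{s₀} ≫ ι ≫ pr₁)^* a') = h_K` (the family is embedded by a power of the universal
`K`-symmetrised polarization, [MumfordFogartyKirwan1994, Thm. 7.9–7.10]; p. 50 "polarized"). THEN the
hypothesis of `weilFamilyReach_hyperbolic_of_polarizedWeilSystem` holds, with
`H := (ι ≫ pr₁)^* a'`: flat sections through every Weil class of `P` with values in the Weil planes and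
of type `(n, n)` everywhere (Voisin II Lemma 4.17 from (4); transport preserves the cohomological Weil
planes; charts (2); Prop. 4.4 from (3)), and `H` rational of type `(1,1)` on every fibre (classes of
`ℙᴺ` are algebraic, pull-backs preserve rationality and Hodge type).
[cite: Deligne1982HodgeCycles, proof of Thm. 4.8 (pp. 47–52), clauses (a)–(c), with Prop. 4.4]
[cite: vanGeemen1994HodgeAV, Lemma 5.2, 5.3–5.4 and 5.8–5.11] [cite: VoisinHodgeII2003, Lemma 4.17]
[cite: MumfordFogartyKirwan1994, Thm. 7.9–7.10] [cite: VoisinHodgeI2002, §7.3.2 and §11.1.2] -/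
theorem polarizedWeilSystem_of_unitaryMonodromyFamily
    (h : ∀ (n d : ℕ), 1 ≤ n → 1 ≤ d →
      ∀ (P : AbelianVariety ℂ) (ψ₀ : P ⟶ P) (e : ProjectiveEmbedding P.X)
        (a : complexBetti (projectiveSpace e.n ℂ) 2),
        P.dim = 2 * n → ψ₀ ≫ ψ₀ = -((d : ℤ) • 𝟙 P) → IsRationalClass a → a ≠ 0 →
        IsHyperbolicWeilType P ψ₀ n
          ((d : ℂ) • complexBetti.map e.ι 2 a +
            complexBetti.map ψ₀.hom.hom.hom 2 (complexBetti.map e.ι 2 a)) →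
        ∃ (𝒳 S : SchemeOver ℂ) (f : 𝒳 ⟶ S) (g : 𝒳 ⟶ 𝒳) (s₀ : ComplexPoints S)
          (e' : P.X ≅ fiberOver f s₀)
          (Y : ComplexPoints S → AbelianVariety ℂ) (Ψ : ∀ s, Y s ⟶ Y s)
          (ε : ∀ s, (Y s).X ≅ fiberOver f s) (N : ℕ)
          (ι : 𝒳 ⟶ CategoryTheory.MonoidalCategoryStruct.tensorObj (projectiveSpace N ℂ) S)
          (a' : complexBetti (projectiveSpace N ℂ) 2),
          IsSmoothProjectiveFamily f (2 * n) ∧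
          AlgebraicGeometry.IsClosedImmersion ι.left ∧
          ι ≫ CategoryTheory.CartesianMonoidalCategory.snd (projectiveSpace N ℂ) S = f ∧
          IrreducibleSpace S.left ∧ AlgebraicGeometry.Smooth S.hom ∧ IsQuasiProjectiveOver S ∧
          g ≫ f = f ∧
          (e'.hom ≫ fiberι f s₀) ≫ g = ψ₀.hom.hom.hom ≫ (e'.hom ≫ fiberι f s₀) ∧
          (∀ s, (Y s).dim = 2 * n ∧ Ψ s ≫ Ψ s = -((d : ℤ) • 𝟙 (Y s)) ∧
            ((ε s).hom ≫ fiberι f s) ≫ g = (Ψ s).hom.hom.hom ≫ ((ε s).hom ≫ fiberι f s) ∧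
            ∀ hY : IsSmoothProjective (2 * n) (Y s).X,
              Module.finrank ℂ
                ↥(Module.End.eigenspace (complexBetti.map (Ψ s).hom.hom.hom 1).hom
                    (Complex.I * (Real.sqrt d : ℂ)) ⊓ hodgeOneZero hY) = n) ∧
          (∀ (hU : IsCohomologicallyLocallyTrivialOn f (Set.univ : Set (ComplexPoints S)))
              (g₀ : fiberOver f s₀ ⟶ fiberOver f s₀), g₀ ≫ fiberι f s₀ = fiberι f s₀ ≫ g →
            ∀ (γ : Path.Homotopic.Quotient
                (⟨s₀, Set.mem_univ s₀⟩ : (Set.univ : Set (ComplexPoints S))) ⟨s₀, Set.mem_univ s₀⟩)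
              (μ : ℂ), (μ = Complex.I * (Real.sqrt d : ℂ) ∨ μ = -(Complex.I * (Real.sqrt d : ℂ))) →
            ∀ hμ : ∀ v ∈ Module.End.eigenspace (complexBetti.map g₀ 1).hom μ,
                transportLinear f 1 hU γ v ∈ Module.End.eigenspace (complexBetti.map g₀ 1).hom μ,
              LinearMap.det ((transportLinear f 1 hU γ).restrict hμ) = 1) ∧
          (∀ (A : AbelianVariety ℂ) (φ : A ⟶ A) (eA : ProjectiveEmbedding A.X)
            (aA : complexBetti (projectiveSpace eA.n ℂ) 2),
            A.dim = 2 * n → φ ≫ φ = -((d : ℤ) • 𝟙 A) → IsRationalClass aA → aA ≠ 0 →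
            IsHyperbolicWeilType A φ n
              ((d : ℂ) • complexBetti.map eA.ι 2 aA +
                complexBetti.map φ.hom.hom.hom 2 (complexBetti.map eA.ι 2 aA)) →
            ∃ (s : ComplexPoints S) (u : Y s ⟶ A) (v : A ⟶ Y s) (m : ℕ),
              AlgebraicGeometry.Flat u.hom.hom.hom.left ∧ 0 < m ∧ u ≫ v = m • 𝟙 (Y s) ∧
                v ≫ Ψ s = φ ≫ v) ∧
          IsRationalClass a' ∧
          complexBetti.map e'.hom 2 (complexBetti.map (fiberι f s₀) 2
            (complexBetti.map
              (ι ≫ CategoryTheory.CartesianMonoidalCategory.fst (projectiveSpace N ℂ) S) 2 a')) =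
            (d : ℂ) • complexBetti.map e.ι 2 a +
              complexBetti.map ψ₀.hom.hom.hom 2 (complexBetti.map e.ι 2 a)) :
    ∀ (n d : ℕ), 1 ≤ n → 1 ≤ d →
      ∀ (P : AbelianVariety ℂ) (ψ₀ : P ⟶ P) (e : ProjectiveEmbedding P.X)
        (a : complexBetti (projectiveSpace e.n ℂ) 2),
        P.dim = 2 * n → ψ₀ ≫ ψ₀ = -((d : ℤ) • 𝟙 P) → IsRationalClass a → a ≠ 0 →
        IsHyperbolicWeilType P ψ₀ n
          ((d : ℂ) • complexBetti.map e.ι 2 a +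
            complexBetti.map ψ₀.hom.hom.hom 2 (complexBetti.map e.ι 2 a)) →
        ∃ (𝒳 S : SchemeOver ℂ) (f : 𝒳 ⟶ S) (s₀ : ComplexPoints S) (e' : P.X ≅ fiberOver f s₀)
          (Y : ComplexPoints S → AbelianVariety ℂ) (Ψ : ∀ s, Y s ⟶ Y s)
          (ε : ∀ s, (Y s).X ≅ fiberOver f s) (H : complexBetti 𝒳 2),
          IsSmoothProjectiveFamily f (2 * n) ∧
          (∃ (N : ℕ) (ι : 𝒳 ⟶ CategoryTheory.MonoidalCategoryStruct.tensorObj (projectiveSpace N ℂ) S),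
            AlgebraicGeometry.IsClosedImmersion ι.left ∧
              ι ≫ CategoryTheory.CartesianMonoidalCategory.snd (projectiveSpace N ℂ) S = f) ∧
          IrreducibleSpace S.left ∧ AlgebraicGeometry.Smooth S.hom ∧ IsQuasiProjectiveOver S ∧
          (∀ s, (Y s).dim = 2 * n ∧ Ψ s ≫ Ψ s = -((d : ℤ) • 𝟙 (Y s))) ∧
          (∀ w : complexBetti P.X (2 * n), w ∈ weilClassesOf P ψ₀ n d →
            ∃ σ : ComplexPoints S → FiberClass f (2 * n),
              Continuous σ ∧ σ s₀ = ⟨s₀, complexBetti.map e'.inv (2 * n) w⟩ ∧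
              ∀ s, ∃ x : complexBetti (fiberOver f s) (2 * n), σ s = ⟨s, x⟩ ∧
                IsOfHodgeType (2 * n) (fiberOver f s) (2 * n) n n x ∧
                complexBetti.map (ε s).hom (2 * n) x ∈ weilClassesOf (Y s) (Ψ s) n d) ∧
          (∀ (A : AbelianVariety ℂ) (φ : A ⟶ A) (eA : ProjectiveEmbedding A.X)
            (aA : complexBetti (projectiveSpace eA.n ℂ) 2),
            A.dim = 2 * n → φ ≫ φ = -((d : ℤ) • 𝟙 A) → IsRationalClass aA → aA ≠ 0 →
            IsHyperbolicWeilType A φ n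
              ((d : ℂ) • complexBetti.map eA.ι 2 aA +
                complexBetti.map φ.hom.hom.hom 2 (complexBetti.map eA.ι 2 aA)) →
            ∃ (s : ComplexPoints S) (u : Y s ⟶ A) (v : A ⟶ Y s) (m : ℕ),
              AlgebraicGeometry.Flat u.hom.hom.hom.left ∧ 0 < m ∧ u ≫ v = m • 𝟙 (Y s) ∧
                v ≫ Ψ s = φ ≫ v) ∧
          (∀ s : ComplexPoints S,
            IsRationalClass (complexBetti.map (fiberι f s) 2 H) ∧
              IsOfHodgeType (2 * n) (fiberOver f s) 2 1 1 (complexBetti.map (fiberι f s) 2 H)) ∧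
          complexBetti.map e'.hom 2 (complexBetti.map (fiberι f s₀) 2 H) =
            (d : ℂ) • complexBetti.map e.ι 2 a +
              complexBetti.map ψ₀.hom.hom.hom 2 (complexBetti.map e.ι 2 a) := by
  intro n d hn hd P ψ₀ e a hP hψ ha ha0 hhyp
  obtain ⟨𝒳, S, f, g, s₀, e', Y, Ψ, ε, N, ι, a', hfam, hιci, hιf, hirr, hsm, hqp, hg, he', hfib,
    hdet, hreach, ha', hH₀⟩ := h n d hn hd P ψ₀ e a hP hψ ha ha0 hhyp
  have hn0 : 0 < n := hn
  have hd0 : 0 < d := hd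
  have hψ' : ψ₀ ≫ ψ₀ = -(d • 𝟙 P) := by rw [hψ, natCast_zsmul]
  -- the base: `S(ℂ)` is a path-connected, locally path-connected manifold and `Rᵏ f_* ℂ` is a
  -- local system on it (Ehresmann)
  haveI := hsm
  haveI := hirr
  haveI : LocallyOfFiniteType S.hom := hqp.locallyOfFiniteType
  haveI : ConnectedSpace (ComplexPoints S) :=
    (Motives.ComplexPoints.connectedSpace_iff_holds S).2 inferInstance
  obtain ⟨dS, hdS⟩ := exists_smoothOfRelativeDimension_of_connectedSpace_complexPoints S
  haveI := hdS
  haveI := pathConnectedSpace_complexPoints_of_smoothOfRelativeDimension S dS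
  letI := Motives.ComplexPoints.chartedSpace S dS
  haveI : LocallyPathConnectedSpace (ComplexPoints S) :=
    ChartedSpace.locallyPathConnectedSpace (EuclideanSpace ℝ (Fin (2 * dS))) (ComplexPoints S)
  have hU := isCohomologicallyLocallyTrivialOn_univ_of_isSmoothProjectiveFamily f dS hfam hqp
  -- the fibre maps of `g`
  have hgf' := fun t ↦ exists_fiberHom_comp_fiberι f g hg t
  choose gf hgf using hgf'
  have he₀ : e'.hom ≫ gf s₀ = ψ₀.hom.hom.hom ≫ e'.hom :=
    hom_comp_fiberHom_eq_of_comp_fiberι f g (hgf s₀) e' ψ₀.hom.hom.hom he'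
  -- the cohomological Weil plane of the fibre over `t`
  let WP : ∀ t : ComplexPoints S, Submodule ℂ (complexBetti (fiberOver f t) (2 * n)) :=
    fun t ↦
      Submodule.span ℂ
        {x | ∃ w : Fin (2 * n) → complexBetti (fiberOver f t) 1,
          (∀ i, w i ∈ Module.End.eigenspace (complexBetti.map (gf t) 1).hom
            (Complex.I * (Real.sqrt d : ℂ))) ∧
          cupPowOne ℂ (ComplexPoints (fiberOver f t)) (2 * n) w = x} ⊔
      Submodule.span ℂ
        {x | ∃ w : Fin (2 * n) → complexBetti (fiberOver f t) 1,
          (∀ i, w i ∈ Module.End.eigenspace (complexBetti.map (gf t) 1).hom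
            (-(Complex.I * (Real.sqrt d : ℂ)))) ∧
          cupPowOne ℂ (ComplexPoints (fiberOver f t)) (2 * n) w = x}
  -- the eigenspaces `V_{±i√d}` of `g_{s₀}^*` on `H¹(𝒳_{s₀})` have dimension `2n` (read on `P`)
  have hrk : ∀ μ : ℂ, (μ = Complex.I * (Real.sqrt d : ℂ) ∨ μ = -(Complex.I * (Real.sqrt d : ℂ))) →
      Module.finrank ℂ ↥(Module.End.eigenspace (complexBetti.map (gf s₀) 1).hom μ) = 2 * n := by
    intro μ hμ
    rw [finrank_eigenspace_eq_of_chart_comm e' (gf s₀) he₀ 1 μ]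
    have hb₁ : Module.finrank ℂ (complexBetti P.X 1) = 2 * (2 * n) := by
      rw [Motives.AbelianVariety.finrank_complexBetti_one, hP]
    have hps : Module.finrank ℂ ↥(Module.End.eigenspace (complexBetti.map ψ₀.hom.hom.hom 1).hom
        (Complex.I * (Real.sqrt d : ℂ))) = 2 * n := by
      have h2 := two_mul_finrank_eigenspace_eq hd0 hψ'
      rw [hb₁] at h2
      omega
    rcases hμ with rfl | rfl
    · exact hps
    · rw [← finrank_eigenspace_eq_finrank_eigenspace_neg hd0 hψ', hps]
  haveI : Module.Finite ℂ ↥(Module.End.eigenspace (complexBetti.map (gf s₀) 1).hom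
      (Complex.I * (Real.sqrt d : ℂ))) :=
    Module.finite_of_finrank_pos (by rw [hrk _ (Or.inl rfl)]; omega)
  haveI : Module.Finite ℂ ↥(Module.End.eigenspace (complexBetti.map (gf s₀) 1).hom
      (-(Complex.I * (Real.sqrt d : ℂ)))) :=
    Module.finite_of_finrank_pos (by rw [hrk _ (Or.inr rfl)]; omega)
  let bμ := Module.finBasisOfFinrankEq ℂ
    ↥(Module.End.eigenspace (complexBetti.map (gf s₀) 1).hom (Complex.I * (Real.sqrt d : ℂ)))
    (hrk _ (Or.inl rfl))
  let bν := Module.finBasisOfFinrankEq ℂ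
    ↥(Module.End.eigenspace (complexBetti.map (gf s₀) 1).hom (-(Complex.I * (Real.sqrt d : ℂ))))
    (hrk _ (Or.inr rfl))
  -- smooth projective varieties around
  have hPN : IsSmoothProjective N (projectiveSpace N ℂ) := isSmoothProjective_projectiveSpace' N
  have ha'11 : IsOfHodgeType N (projectiveSpace N ℂ) (2 * 1) 1 1 a' :=
    isOfHodgeType_of_mem_algebraicClasses_of_isSmoothProjective hPN 1
      (by rw [algebraicClasses_projectiveSpace_eq_top]; exact Submodule.mem_top)
  refine ⟨𝒳, S, f, s₀, e', Y, Ψ, ε,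
    complexBetti.map (ι ≫ CategoryTheory.CartesianMonoidalCategory.fst (projectiveSpace N ℂ) S) 2 a',
    hfam, ⟨N, ι, hιci, hιf⟩, hirr, hsm, hqp, fun s ↦ ⟨(hfib s).1, (hfib s).2.1⟩, ?_, hreach,
    fun s ↦ ?_, hH₀⟩
  · -- flat sections through every Weil class of `P`, Weil-valued and of type `(n, n)` everywhere
    intro w hw
    have hα : complexBetti.map e'.inv (2 * n) w ∈ WP s₀ :=
      map_inv_mem_eigenLines_of_mem_weilClassesOf e' (gf s₀) hd0 hP hψ' he₀ hw
    obtain ⟨σ, hσ, hpt, hσ₀⟩ := exists_continuous_section_of_det_restrict_eq_one f hU g hg gf hgf s₀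
      (Complex.I * (Real.sqrt d : ℂ)) (-(Complex.I * (Real.sqrt d : ℂ))) bμ bν
      (fun γ ↦ ⟨hdet hU (gf s₀) (hgf s₀) γ _ (Or.inl rfl)
          (fun _ hv ↦ transportFun_mem_eigenspace_fiberHom f 1 hU g hg gf hgf γ hv),
        hdet hU (gf s₀) (hgf s₀) γ _ (Or.inr rfl)
          (fun _ hv ↦ transportFun_mem_eigenspace_fiberHom f 1 hU g hg gf hgf γ hv)⟩) hα
    refine ⟨σ, hσ, hσ₀, fun s ↦ ?_⟩
    -- the value at `s` is the transport of `e'^{-1 *} w`, hence in the Weil plane of `𝒳_s`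
    have key : (σ s).clsAt (hpt s) ∈ WP s := by
      let γ : Path (⟨s₀, Set.mem_univ s₀⟩ : (Set.univ : Set (ComplexPoints S))) ⟨s, Set.mem_univ s⟩ :=
        (PathConnectedSpace.somePath s₀ s).map (continuous_id.subtype_mk _)
      have htr := transportFun_clsAt_of_continuous f (2 * n) hU hσ hpt γ
      have h0 : (σ s₀).clsAt (hpt s₀) = complexBetti.map e'.inv (2 * n) w := by
        rw [FiberClass.clsAt_eq_iff]; exact hσ₀
      change transportFun f (2 * n) hU ⟦γ⟧ ((σ s₀).clsAt (hpt s₀)) = (σ s).clsAt (hpt s) at htr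
      rw [← htr, h0]
      exact transportFun_mem_eigenLines f hU g hg gf hgf ⟦γ⟧ _ _ (2 * n) hα
    obtain ⟨hYd, hΨ, hεg, hbal⟩ := hfib s
    have hΨ' : Ψ s ≫ Ψ s = -(d • 𝟙 (Y s)) := by rw [hΨ, natCast_zsmul]
    have hεs : (ε s).hom ≫ gf s = (Ψ s).hom.hom.hom ≫ (ε s).hom :=
      hom_comp_fiberHom_eq_of_comp_fiberι f g (hgf s) (ε s) (Ψ s).hom.hom.hom hεg
    have hmemA : complexBetti.map (ε s).hom (2 * n) ((σ s).clsAt (hpt s)) ∈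
        weilClassesOf (Y s) (Ψ s) n d :=
      map_mem_weilClassesOf_of_mem_eigenLines (ε s) (gf s) hεs key
    refine ⟨(σ s).clsAt (hpt s), (FiberClass.mk_clsAt _ _).symm, ?_, hmemA⟩
    -- of type `(n, n)`: Prop. 4.4 on the balanced chart `(Y_s, Ψ_s)`, carried back along `ε_s`
    have htyp := (isOfHodgeType_of_mem_weilClassesOf hn0 hYd hd0 hΨ' (hbal _) hmemA).map_of_iso
      (ε s).symm
    have hid : singularCohomology.map ℂ ℂ (Motives.AlgPoints.mapContinuous (L := ℂ) (ε s).symm.hom)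
        (2 * n) (complexBetti.map (ε s).hom (2 * n) ((σ s).clsAt (hpt s))) = (σ s).clsAt (hpt s) := by
      change complexBetti.map (ε s).inv (2 * n) (complexBetti.map (ε s).hom (2 * n) _) = _
      rw [← ModuleCat.comp_apply, ← complexBetti.map_comp, (ε s).inv_hom_id, complexBetti.map_id]
      rfl
    rw [hid] at htyp
    exact htyp
  · -- clause (a): `H|_{𝒳_s} = (ι_s ≫ ι ≫ pr₁)^* a'` is rational of type `(1,1)`
    have hHs : complexBetti.map (fiberι f s) 2
        (complexBetti.map
          (ι ≫ CategoryTheory.CartesianMonoidalCategory.fst (projectiveSpace N ℂ) S) 2 a') =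
        complexBetti.map
          (fiberι f s ≫ ι ≫ CategoryTheory.CartesianMonoidalCategory.fst (projectiveSpace N ℂ) S)
          2 a' := by
      rw [complexBetti.map_comp (fiberι f s), ModuleCat.comp_apply]
    rw [hHs]
    exact ⟨ha'.map _, ha'11.map_of_isSmoothProjective (hfam.isSmoothProjective s) hPN _⟩

/-- **`weilFamilyReach_hyperbolic` from Deligne's construction outputs**: the abelian scheme with
`K`-action over the hyperbolic component, balanced fibres, special-unitary monodromy at `s₀`, reach
by `K`-isogeny and the polarization equation at `s₀` (the hypothesis of
`polarizedWeilSystem_of_unitaryMonodromyFamily`, stated inline) imply the named fact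
`weilFamilyReach_hyperbolic` (`polarizedWeilSystem_of_unitaryMonodromyFamily` followed by
`weilFamilyReach_hyperbolic_of_polarizedWeilSystem`).
[cite: Deligne1982HodgeCycles, proof of Thm. 4.8 (pp. 47–52) with Prop. 4.4]
[cite: vanGeemen1994HodgeAV, Lemma 5.2, 5.3–5.4 and 5.8–5.11]
[cite: MumfordFogartyKirwan1994, Thm. 7.9–7.10] [cite: Milne1986AbelianVarieties, §8 Prop. 8.1] -/
theorem weilFamilyReach_hyperbolic_of_unitaryMonodromyFamily
    (h : ∀ (n d : ℕ), 1 ≤ n → 1 ≤ d →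
      ∀ (P : AbelianVariety ℂ) (ψ₀ : P ⟶ P) (e : ProjectiveEmbedding P.X)
        (a : complexBetti (projectiveSpace e.n ℂ) 2),
        P.dim = 2 * n → ψ₀ ≫ ψ₀ = -((d : ℤ) • 𝟙 P) → IsRationalClass a → a ≠ 0 →
        IsHyperbolicWeilType P ψ₀ n
          ((d : ℂ) • complexBetti.map e.ι 2 a +
            complexBetti.map ψ₀.hom.hom.hom 2 (complexBetti.map e.ι 2 a)) →
        ∃ (𝒳 S : SchemeOver ℂ) (f : 𝒳 ⟶ S) (g : 𝒳 ⟶ 𝒳) (s₀ : ComplexPoints S)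
          (e' : P.X ≅ fiberOver f s₀)
          (Y : ComplexPoints S → AbelianVariety ℂ) (Ψ : ∀ s, Y s ⟶ Y s)
          (ε : ∀ s, (Y s).X ≅ fiberOver f s) (N : ℕ)
          (ι : 𝒳 ⟶ CategoryTheory.MonoidalCategoryStruct.tensorObj (projectiveSpace N ℂ) S)
          (a' : complexBetti (projectiveSpace N ℂ) 2),
          IsSmoothProjectiveFamily f (2 * n) ∧
          AlgebraicGeometry.IsClosedImmersion ι.left ∧
          ι ≫ CategoryTheory.CartesianMonoidalCategory.snd (projectiveSpace N ℂ) S = f ∧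
          IrreducibleSpace S.left ∧ AlgebraicGeometry.Smooth S.hom ∧ IsQuasiProjectiveOver S ∧
          g ≫ f = f ∧
          (e'.hom ≫ fiberι f s₀) ≫ g = ψ₀.hom.hom.hom ≫ (e'.hom ≫ fiberι f s₀) ∧
          (∀ s, (Y s).dim = 2 * n ∧ Ψ s ≫ Ψ s = -((d : ℤ) • 𝟙 (Y s)) ∧
            ((ε s).hom ≫ fiberι f s) ≫ g = (Ψ s).hom.hom.hom ≫ ((ε s).hom ≫ fiberι f s) ∧
            ∀ hY : IsSmoothProjective (2 * n) (Y s).X,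
              Module.finrank ℂ
                ↥(Module.End.eigenspace (complexBetti.map (Ψ s).hom.hom.hom 1).hom
                    (Complex.I * (Real.sqrt d : ℂ)) ⊓ hodgeOneZero hY) = n) ∧
          (∀ (hU : IsCohomologicallyLocallyTrivialOn f (Set.univ : Set (ComplexPoints S)))
              (g₀ : fiberOver f s₀ ⟶ fiberOver f s₀), g₀ ≫ fiberι f s₀ = fiberι f s₀ ≫ g →
            ∀ (γ : Path.Homotopic.Quotient
                (⟨s₀, Set.mem_univ s₀⟩ : (Set.univ : Set (ComplexPoints S))) ⟨s₀, Set.mem_univ s₀⟩)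
              (μ : ℂ), (μ = Complex.I * (Real.sqrt d : ℂ) ∨ μ = -(Complex.I * (Real.sqrt d : ℂ))) →
            ∀ hμ : ∀ v ∈ Module.End.eigenspace (complexBetti.map g₀ 1).hom μ,
                transportLinear f 1 hU γ v ∈ Module.End.eigenspace (complexBetti.map g₀ 1).hom μ,
              LinearMap.det ((transportLinear f 1 hU γ).restrict hμ) = 1) ∧
          (∀ (A : AbelianVariety ℂ) (φ : A ⟶ A) (eA : ProjectiveEmbedding A.X)
            (aA : complexBetti (projectiveSpace eA.n ℂ) 2),
            A.dim = 2 * n → φ ≫ φ = -((d : ℤ) • 𝟙 A) → IsRationalClass aA → aA ≠ 0 →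
            IsHyperbolicWeilType A φ n
              ((d : ℂ) • complexBetti.map eA.ι 2 aA +
                complexBetti.map φ.hom.hom.hom 2 (complexBetti.map eA.ι 2 aA)) →
            ∃ (s : ComplexPoints S) (u : Y s ⟶ A) (v : A ⟶ Y s) (m : ℕ),
              AlgebraicGeometry.Flat u.hom.hom.hom.left ∧ 0 < m ∧ u ≫ v = m • 𝟙 (Y s) ∧
                v ≫ Ψ s = φ ≫ v) ∧
          IsRationalClass a' ∧
          complexBetti.map e'.hom 2 (complexBetti.map (fiberι f s₀) 2
            (complexBetti.map
              (ι ≫ CategoryTheory.CartesianMonoidalCategory.fst (projectiveSpace N ℂ) S) 2 a')) =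
            (d : ℂ) • complexBetti.map e.ι 2 a +
              complexBetti.map ψ₀.hom.hom.hom 2 (complexBetti.map e.ι 2 a)) :
    weilFamilyReach_hyperbolic :=
  weilFamilyReach_hyperbolic_of_polarizedWeilSystem (polarizedWeilSystem_of_unitaryMonodromyFamily h)

/-- **`weilFamily_hyperbolic_weilSystem_reach` from Deligne's construction outputs** (same
hypothesis; `polarizedWeilSystem_of_unitaryMonodromyFamily` followed by
`weilFamily_hyperbolic_weilSystem_reach_of_polarizedWeilSystem`).
[cite: Deligne1982HodgeCycles, proof of Thm. 4.8 (pp. 47–52) with Prop. 4.4]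
[cite: vanGeemen1994HodgeAV, Lemma 5.2, 5.3–5.4 and 5.8–5.11] -/
theorem weilFamily_hyperbolic_weilSystem_reach_of_unitaryMonodromyFamily
    (h : ∀ (n d : ℕ), 1 ≤ n → 1 ≤ d →
      ∀ (P : AbelianVariety ℂ) (ψ₀ : P ⟶ P) (e : ProjectiveEmbedding P.X)
        (a : complexBetti (projectiveSpace e.n ℂ) 2),
        P.dim = 2 * n → ψ₀ ≫ ψ₀ = -((d : ℤ) • 𝟙 P) → IsRationalClass a → a ≠ 0 →
        IsHyperbolicWeilType P ψ₀ n
          ((d : ℂ) • complexBetti.map e.ι 2 a +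
            complexBetti.map ψ₀.hom.hom.hom 2 (complexBetti.map e.ι 2 a)) →
        ∃ (𝒳 S : SchemeOver ℂ) (f : 𝒳 ⟶ S) (g : 𝒳 ⟶ 𝒳) (s₀ : ComplexPoints S)
          (e' : P.X ≅ fiberOver f s₀)
          (Y : ComplexPoints S → AbelianVariety ℂ) (Ψ : ∀ s, Y s ⟶ Y s)
          (ε : ∀ s, (Y s).X ≅ fiberOver f s) (N : ℕ)
          (ι : 𝒳 ⟶ CategoryTheory.MonoidalCategoryStruct.tensorObj (projectiveSpace N ℂ) S)
          (a' : complexBetti (projectiveSpace N ℂ) 2),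
          IsSmoothProjectiveFamily f (2 * n) ∧
          AlgebraicGeometry.IsClosedImmersion ι.left ∧
          ι ≫ CategoryTheory.CartesianMonoidalCategory.snd (projectiveSpace N ℂ) S = f ∧
          IrreducibleSpace S.left ∧ AlgebraicGeometry.Smooth S.hom ∧ IsQuasiProjectiveOver S ∧
          g ≫ f = f ∧
          (e'.hom ≫ fiberι f s₀) ≫ g = ψ₀.hom.hom.hom ≫ (e'.hom ≫ fiberι f s₀) ∧
          (∀ s, (Y s).dim = 2 * n ∧ Ψ s ≫ Ψ s = -((d : ℤ) • 𝟙 (Y s)) ∧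
            ((ε s).hom ≫ fiberι f s) ≫ g = (Ψ s).hom.hom.hom ≫ ((ε s).hom ≫ fiberι f s) ∧
            ∀ hY : IsSmoothProjective (2 * n) (Y s).X,
              Module.finrank ℂ
                ↥(Module.End.eigenspace (complexBetti.map (Ψ s).hom.hom.hom 1).hom
                    (Complex.I * (Real.sqrt d : ℂ)) ⊓ hodgeOneZero hY) = n) ∧
          (∀ (hU : IsCohomologicallyLocallyTrivialOn f (Set.univ : Set (ComplexPoints S)))
              (g₀ : fiberOver f s₀ ⟶ fiberOver f s₀), g₀ ≫ fiberι f s₀ = fiberι f s₀ ≫ g →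
            ∀ (γ : Path.Homotopic.Quotient
                (⟨s₀, Set.mem_univ s₀⟩ : (Set.univ : Set (ComplexPoints S))) ⟨s₀, Set.mem_univ s₀⟩)
              (μ : ℂ), (μ = Complex.I * (Real.sqrt d : ℂ) ∨ μ = -(Complex.I * (Real.sqrt d : ℂ))) →
            ∀ hμ : ∀ v ∈ Module.End.eigenspace (complexBetti.map g₀ 1).hom μ,
                transportLinear f 1 hU γ v ∈ Module.End.eigenspace (complexBetti.map g₀ 1).hom μ,
              LinearMap.det ((transportLinear f 1 hU γ).restrict hμ) = 1) ∧
          (∀ (A : AbelianVariety ℂ) (φ : A ⟶ A) (eA : ProjectiveEmbedding A.X)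
            (aA : complexBetti (projectiveSpace eA.n ℂ) 2),
            A.dim = 2 * n → φ ≫ φ = -((d : ℤ) • 𝟙 A) → IsRationalClass aA → aA ≠ 0 →
            IsHyperbolicWeilType A φ n
              ((d : ℂ) • complexBetti.map eA.ι 2 aA +
                complexBetti.map φ.hom.hom.hom 2 (complexBetti.map eA.ι 2 aA)) →
            ∃ (s : ComplexPoints S) (u : Y s ⟶ A) (v : A ⟶ Y s) (m : ℕ),
              AlgebraicGeometry.Flat u.hom.hom.hom.left ∧ 0 < m ∧ u ≫ v = m • 𝟙 (Y s) ∧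
                v ≫ Ψ s = φ ≫ v) ∧
          IsRationalClass a' ∧
          complexBetti.map e'.hom 2 (complexBetti.map (fiberι f s₀) 2
            (complexBetti.map
              (ι ≫ CategoryTheory.CartesianMonoidalCategory.fst (projectiveSpace N ℂ) S) 2 a')) =
            (d : ℂ) • complexBetti.map e.ι 2 a +
              complexBetti.map ψ₀.hom.hom.hom 2 (complexBetti.map e.ι 2 a)) :
    weilFamily_hyperbolic_weilSystem_reach :=
  weilFamily_hyperbolic_weilSystem_reach_of_polarizedWeilSystem
    (polarizedWeilSystem_of_unitaryMonodromyFamily h)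

end Literature.AlgebraicGeometry.HodgeTheory

end
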